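import Literature.NumberTheory.ConnesMoscovici2022.UVProlateSpectrumProofs
import Literature.Analysis.Fourier.L2FourierReflection
import HarnessLib

/-!
# Connes–Moscovici 2022, §1: `dom W_max` is Fourier- and reflection-invariant; `Ω` is
`𝔽_{e_ℝ}`-invariant — the LEAF of the Fourier road to Theorem 1.6 (i)

LINE 1 — FRAMING. RH-FREE corpus literature (cell rh-crit, C1 Connes–Consani/Moscovici corpus,
row O2 `UVProlateSpectrum`: the self-adjointness theory of the prolate wave operator
`W_λ = −∂ₓ(λ² − x²)∂ₓ + (2πλx)²` on `L²(ℝ)`; sequel material, no leaf / binder role in any route).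
bears_on: LADDER-RH W-C/W-P.  WHAT THIS IS NOT: any claim about `ζ` or RH — that a differential
operator commutes with the Fourier transform says nothing about zeta zeros; nothing in this file
bears on the truth of RH.  Theorems only: 0 `def`s, 0 named facts, no `sorry`.

Source: A. Connes, H. Moscovici, *The UV prolate spectrum matches the zeros of zeta*, PNAS 119
(2022) [bib `ConnesMoscovici2022`] = arXiv:2112.05500, §1 ¶1 (= arXiv §2 ¶1, held text
`paper-arxiv-2112.05500`, chunk p0004:L24–L37):

> "In addition `W` has the remarkable property of commuting with the Fourier transform
> `𝔽_{e_ℝ}(f)(y) := ∫ f(x) exp(−2πixy) dx`.  Since both the Schwartz space `𝒮(ℝ)` and its dual are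
> globally invariant under the Fourier transform, the domains `dom W_min` and `dom W_max` are
> invariant too, therefore both `W_min` and `W_max` commute with `𝔽_{e_ℝ}`."

and the step of the proof of Theorem 1.6 (i) (= arXiv Thm 2.6, chunk p0006:L38–L41, L81):

> "Since both `dom(W_min)` and `dom(W_max)`, as well as the symplectic form `Ω`, are globally
> invariant under the Fourier transform …"

## Contents (all PROVED)

* §A (generic, `LinearPMap` namespace, beside the tree's `LinearPMap.adjoint_clm_apply_of_comm`):
  `LinearPMap.adjoint_clm_apply_of_core_map` — if bounded `U, V` satisfy `⟪U x, y⟫ = ⟪x, V y⟫` and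
  `V` maps the (dense) domain of `T` into itself with `T (V y) = V (T y)`, then `U` maps `dom T†`
  into itself and `T† (U ξ) = U (T† ξ)`.  (The duality step "`𝒮'` is invariant" of the quote.)
* §B `prolateSchwartz_fourierInv` — `W (𝓕⁻ f) = 𝓕⁻ (W f)` on `𝒮(ℝ)` (from the tree's
  `fourier_prolateSchwartz`, t8 g2).
* §C **`fourierL2_mem_prolateMax` / `prolateMax_fourierL2`**, `fourierInv_mem_prolateMax` /
  `prolateMax_fourierInv`: `dom W_max` is invariant under `𝓕` and `𝓕⁻¹` and
  `W_max (𝓕 ξ) = 𝓕 (W_max ξ)`; **`commutesWith_prolateMax_fourierL2`** (the tree's `CommutesWith`).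
* §D `compNeg_mem_prolateMax` / `prolateMax_compNeg`: `dom W_max` is invariant under the reflection
  `R ξ = ξ(−·)` ("`W` is … invariant under the parity exchange `x ↦ −x`", p0004:L14) — via `𝓕𝓕 = R`.
* §E **`omegaForm_fourierL2`**: `Ω(𝓕ξ, 𝓕η) = Ω(ξ, η)`; `omegaForm_fourierL2_left`:
  `Ω(𝓕ξ, η) = Ω(ξ, 𝓕⁻η)`.

Consumers: `UVProlateFourierInvariance.lean` (this seat: Thm 1.6 (i) 𝓕-clause, (ii) `P̂_λ`),
`UVProlateQuotientBasisVectors.lean` (cc-t8: `α̂±, β̂± ∈ dom W_max` for Lemma 1.5).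
-/

noncomputable section

open Complex Set MeasureTheory Filter SchwartzMap FourierTransform
open scoped Real Topology ENNReal InnerProductSpace

/-! ## §A. Generic: a bounded operator whose adjoint partner preserves the core maps `dom T†` to itself -/

namespace LinearPMap

variable {𝕜 E : Type*} [RCLike 𝕜] [NormedAddCommGroup E] [InnerProductSpace 𝕜 E] [CompleteSpace E]

/-- (Dot-notation extension of Mathlib's `LinearPMap`, declared deliberately in that namespace,
beside the tree's `LinearPMap.adjoint_clm_apply_of_comm`.)  **Duality step.**  Let `T` be densely
defined and let `U, V` be bounded operators with `⟪U x, y⟫ = ⟪x, V y⟫` (i.e. `V = U*`).  If `V`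
maps `dom T` into itself and `T (V y) = V (T y)` there, then `U` maps `dom T†` into itself and
`T† (U ξ) = U (T† ξ)`.  (For `T = W` on `𝒮(ℝ)`, `U = 𝔽_{e_ℝ}`, `V = 𝔽_{e_ℝ}⁻¹`: "since both the
Schwartz space and its dual are globally invariant under the Fourier transform, … `W_max`
commute[s] with `𝔽_{e_ℝ}`".)
[cite: ConnesMoscovici2022, §1 ¶1 (= arXiv:2112.05500 §2 ¶1, chunk p0004:L29–L37)] -/
theorem adjoint_clm_apply_of_core_map {T : E →ₗ.[𝕜] E} (hT : Dense (T.domain : Set E))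
    (U V : E →L[𝕜] E) (hUV : ∀ x y : E, ⟪U x, y⟫_𝕜 = ⟪x, V y⟫_𝕜)
    (hV : ∀ y : T.domain, ∃ h : V (y : E) ∈ T.domain, T ⟨V (y : E), h⟩ = V (T y))
    (ξ : T.adjoint.domain) :
    ∃ h : U (ξ : E) ∈ T.adjoint.domain, T.adjoint ⟨U (ξ : E), h⟩ = U (T.adjoint ξ) := by
  have hw : ∀ y : T.domain, ⟪U (T.adjoint ξ), (y : E)⟫_𝕜 = ⟪U (ξ : E), T y⟫_𝕜 := by
    intro y
    obtain ⟨hVy, hTVy⟩ := hV y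
    rw [hUV, hUV, ← hTVy]
    exact adjoint_isFormalAdjoint hT ξ ⟨V (y : E), hVy⟩
  have hdom : U (ξ : E) ∈ T.adjoint.domain := mem_adjoint_domain_of_exists _ ⟨_, hw⟩
  exact ⟨hdom, adjoint_apply_eq hT ⟨_, hdom⟩ hw⟩

end LinearPMap

namespace Literature.NumberTheory.ConnesMoscovici2022

open Literature.NumberTheory.ConnesConsani2021

variable {lam : ℝ}

/-! ## §B. `W` commutes with `𝓕⁻¹` on the Schwartz core -/

/-- RH-FREE (PROVED). `W (𝓕⁻ f) = 𝓕⁻ (W f)` for `f ∈ 𝒮(ℝ)`: apply `𝓕⁻` to the tree's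
`fourier_prolateSchwartz` at `𝓕⁻ f`.
[cite: ConnesMoscovici2022, §1 ¶1, eq. (1.3) (= arXiv §2 ¶1, (2.3), chunk p0004:L29–L37)] -/
theorem prolateSchwartz_fourierInv (lam : ℝ) (f : 𝓢(ℝ, ℂ)) :
    prolateSchwartz lam (𝓕⁻ f) = 𝓕⁻ (prolateSchwartz lam f) := by
  have h := fourier_prolateSchwartz lam (𝓕⁻ f)
  rw [fourier_fourierInv_eq] at h
  rw [← h, fourierInv_fourier_eq]

/-! ## §C. `dom W_max` is `𝓕`- and `𝓕⁻¹`-invariant and `W_max` commutes with both -/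

/-- `⟪𝓕 x, y⟫ = ⟪x, 𝓕⁻ y⟫` on `L²(ℝ)` (unitarity). [folklore] -/
private theorem inner_fourier_left (x y : L2R) :
    ⟪(𝓕 x : L2R), y⟫_ℂ = ⟪x, (𝓕⁻ y : L2R)⟫_ℂ := by
  have h := Lp.inner_fourier_eq x (𝓕⁻ y : L2R)
  rw [fourier_fourierInv_eq] at h
  exact h

/-- `⟪𝓕⁻ x, y⟫ = ⟪x, 𝓕 y⟫` on `L²(ℝ)` (unitarity). [folklore] -/
private theorem inner_fourierInv_left (x y : L2R) :
    ⟪(𝓕⁻ x : L2R), y⟫_ℂ = ⟪x, (𝓕 y : L2R)⟫_ℂ := by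
  have h := Lp.inner_fourier_eq (𝓕⁻ x : L2R) y
  rw [fourier_fourierInv_eq] at h
  exact h.symm

/-- The `L²` Fourier transform as a continuous linear map (coercion of Mathlib's isometry). [folklore] -/
private theorem fourierCLM_apply (x : L2R) :
    ((Lp.fourierTransformₗᵢ ℝ ℂ).toContinuousLinearEquiv : L2R →L[ℂ] L2R) x = (𝓕 x : L2R) := rfl

/-- The inverse `L²` Fourier transform as a continuous linear map. [folklore] -/
private theorem fourierInvCLM_apply (x : L2R) :
    ((Lp.fourierTransformₗᵢ ℝ ℂ).symm.toContinuousLinearEquiv : L2R →L[ℂ] L2R) x = (𝓕⁻ x : L2R) :=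
  rfl

/-- `𝓕⁻` maps the core `𝒮(ℝ) ⊂ L²(ℝ)` into itself and commutes with `W` there. [cite: ConnesMoscovici2022, §1 ¶1 (= arXiv §2 ¶1, chunk p0004:L29–L37)] -/
private theorem core_map_fourierInv (lam : ℝ) (y : (prolateCore lam).domain) :
    ∃ h : (𝓕⁻ (y : L2R) : L2R) ∈ (prolateCore lam).domain,
      prolateCore lam ⟨(𝓕⁻ (y : L2R) : L2R), h⟩ = (𝓕⁻ (prolateCore lam y) : L2R) := by
  obtain ⟨φ, hφ⟩ := LinearMap.mem_range.mp y.2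
  have hy : y = ⟨schwartzToL2 φ, LinearMap.mem_range_self _ φ⟩ := Subtype.ext hφ.symm
  subst hy
  have h1 : (𝓕⁻ (schwartzToL2 φ) : L2R) = schwartzToL2 (𝓕⁻ φ) := by
    change (𝓕⁻ (φ.toLp 2 volume) : L2R) = (𝓕⁻ φ).toLp 2 volume
    exact SchwartzMap.toLp_fourierInv_eq φ
  refine ⟨?_, ?_⟩
  · rw [h1]; exact LinearMap.mem_range_self _ _
  · have h2 : (⟨(𝓕⁻ (schwartzToL2 φ) : L2R), by rw [h1]; exact LinearMap.mem_range_self _ _⟩ :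
        (prolateCore lam).domain) = ⟨schwartzToL2 (𝓕⁻ φ), LinearMap.mem_range_self _ _⟩ :=
      Subtype.ext h1
    rw [h2, prolateCore_apply, prolateCore_apply, prolateSchwartz_fourierInv]
    change ((𝓕⁻ (prolateSchwartz lam φ)).toLp 2 volume : L2R) =
      (𝓕⁻ ((prolateSchwartz lam φ).toLp 2 volume) : L2R)
    exact (SchwartzMap.toLp_fourierInv_eq _).symm

/-- `𝓕` maps the core `𝒮(ℝ) ⊂ L²(ℝ)` into itself and commutes with `W` there. [cite: ConnesMoscovici2022, §1 ¶1 (= arXiv §2 ¶1, chunk p0004:L29–L37)] -/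
private theorem core_map_fourier (lam : ℝ) (y : (prolateCore lam).domain) :
    ∃ h : (𝓕 (y : L2R) : L2R) ∈ (prolateCore lam).domain,
      prolateCore lam ⟨(𝓕 (y : L2R) : L2R), h⟩ = (𝓕 (prolateCore lam y) : L2R) := by
  obtain ⟨φ, hφ⟩ := LinearMap.mem_range.mp y.2
  have hy : y = ⟨schwartzToL2 φ, LinearMap.mem_range_self _ φ⟩ := Subtype.ext hφ.symm
  subst hy
  have h1 : (𝓕 (schwartzToL2 φ) : L2R) = schwartzToL2 (𝓕 φ) := by
    change (𝓕 (φ.toLp 2 volume) : L2R) = (𝓕 φ).toLp 2 volume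
    exact SchwartzMap.toLp_fourier_eq φ
  refine ⟨?_, ?_⟩
  · rw [h1]; exact LinearMap.mem_range_self _ _
  · have h2 : (⟨(𝓕 (schwartzToL2 φ) : L2R), by rw [h1]; exact LinearMap.mem_range_self _ _⟩ :
        (prolateCore lam).domain) = ⟨schwartzToL2 (𝓕 φ), LinearMap.mem_range_self _ _⟩ :=
      Subtype.ext h1
    rw [h2, prolateCore_apply, prolateCore_apply, ← fourier_prolateSchwartz]
    change ((𝓕 (prolateSchwartz lam φ)).toLp 2 volume : L2R) =
      (𝓕 ((prolateSchwartz lam φ).toLp 2 volume) : L2R)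
    exact (SchwartzMap.toLp_fourier_eq _).symm

/-- RH-FREE (PROVED). **`dom W_max` is invariant under the Fourier transform and
`W_max (𝓕 ξ) = 𝓕 (W_max ξ)`** ("both `W_min` and `W_max` commute with `𝔽_{e_ℝ}`"), stated with
Mathlib's `𝓕` on `L²(ℝ)` (= the tree's `fourierL2`, definitionally).
[cite: ConnesMoscovici2022, §1 ¶1 (= arXiv:2112.05500 §2 ¶1, chunk p0004:L29–L37)] -/
theorem fourier_mem_prolateMax (lam : ℝ) (ξ : (prolateMax lam).domain) :
    ∃ h : (𝓕 (ξ : L2R) : L2R) ∈ (prolateMax lam).domain,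
      prolateMax lam ⟨(𝓕 (ξ : L2R) : L2R), h⟩ = (𝓕 (prolateMax lam ξ) : L2R) := by
  have h := LinearPMap.adjoint_clm_apply_of_core_map (T := prolateCore lam) dense_schwartzL2
    ((Lp.fourierTransformₗᵢ ℝ ℂ).toContinuousLinearEquiv : L2R →L[ℂ] L2R)
    ((Lp.fourierTransformₗᵢ ℝ ℂ).symm.toContinuousLinearEquiv : L2R →L[ℂ] L2R)
    (fun x y ↦ by rw [fourierCLM_apply, fourierInvCLM_apply]; exact inner_fourier_left x y)
    (fun y ↦ by
      simp only [fourierInvCLM_apply]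
      exact core_map_fourierInv lam y) ξ
  change ∃ h : ((Lp.fourierTransformₗᵢ ℝ ℂ).toContinuousLinearEquiv : L2R →L[ℂ] L2R) (ξ : L2R) ∈
      (prolateCore lam).adjoint.domain,
    (prolateCore lam).adjoint ⟨_, h⟩ =
      ((Lp.fourierTransformₗᵢ ℝ ℂ).toContinuousLinearEquiv : L2R →L[ℂ] L2R) ((prolateCore lam).adjoint ξ)
  exact h

/-- RH-FREE (PROVED). `dom W_max` is invariant under `𝓕⁻¹` and `W_max (𝓕⁻¹ ξ) = 𝓕⁻¹ (W_max ξ)`.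
[cite: ConnesMoscovici2022, §1 ¶1 (= arXiv:2112.05500 §2 ¶1, chunk p0004:L29–L37)] -/
theorem fourierInv_mem_prolateMax (lam : ℝ) (ξ : (prolateMax lam).domain) :
    ∃ h : (𝓕⁻ (ξ : L2R) : L2R) ∈ (prolateMax lam).domain,
      prolateMax lam ⟨(𝓕⁻ (ξ : L2R) : L2R), h⟩ = (𝓕⁻ (prolateMax lam ξ) : L2R) := by
  have h := LinearPMap.adjoint_clm_apply_of_core_map (T := prolateCore lam) dense_schwartzL2
    ((Lp.fourierTransformₗᵢ ℝ ℂ).symm.toContinuousLinearEquiv : L2R →L[ℂ] L2R)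
    ((Lp.fourierTransformₗᵢ ℝ ℂ).toContinuousLinearEquiv : L2R →L[ℂ] L2R)
    (fun x y ↦ by rw [fourierCLM_apply, fourierInvCLM_apply]; exact inner_fourierInv_left x y)
    (fun y ↦ by
      simp only [fourierCLM_apply]
      exact core_map_fourier lam y) ξ
  change ∃ h : ((Lp.fourierTransformₗᵢ ℝ ℂ).symm.toContinuousLinearEquiv : L2R →L[ℂ] L2R) (ξ : L2R) ∈
      (prolateCore lam).adjoint.domain,
    (prolateCore lam).adjoint ⟨_, h⟩ =
      ((Lp.fourierTransformₗᵢ ℝ ℂ).symm.toContinuousLinearEquiv : L2R →L[ℂ] L2R)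
        ((prolateCore lam).adjoint ξ)
  exact h

/-- RH-FREE (PROVED). The tree's spelling: `fourierL2 ξ ∈ dom W_max` for `ξ ∈ dom W_max`.
[cite: ConnesMoscovici2022, §1 ¶1 (= arXiv:2112.05500 §2 ¶1, chunk p0004:L29–L37)] -/
theorem fourierL2_mem_prolateMax (lam : ℝ) {ξ : L2R} (hξ : ξ ∈ (prolateMax lam).domain) :
    fourierL2 ξ ∈ (prolateMax lam).domain :=
  (fourier_mem_prolateMax lam ⟨ξ, hξ⟩).1

/-- RH-FREE (PROVED). The tree's spelling: `W_max (fourierL2 ξ) = fourierL2 (W_max ξ)`.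
[cite: ConnesMoscovici2022, §1 ¶1 (= arXiv:2112.05500 §2 ¶1, chunk p0004:L29–L37)] -/
theorem prolateMax_fourierL2 (lam : ℝ) (ξ : (prolateMax lam).domain) :
    prolateMax lam ⟨fourierL2 (ξ : L2R), fourierL2_mem_prolateMax lam ξ.2⟩ =
      fourierL2 (prolateMax lam ξ) := by
  obtain ⟨h, h'⟩ := fourier_mem_prolateMax lam ξ
  exact h'

/-- RH-FREE (PROVED). **`W_max` commutes with the Fourier transform** in the sense of the tree's
`CommutesWith` (used verbatim in the typed `CM22_thm_1_6`).
[cite: ConnesMoscovici2022, §1 ¶1 (= arXiv:2112.05500 §2 ¶1, chunk p0004:L29–L37)] -/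
theorem commutesWith_prolateMax_fourierL2 (lam : ℝ) : CommutesWith (prolateMax lam) fourierL2 :=
  fun ξ ↦ fourier_mem_prolateMax lam ξ

/-- RH-FREE (PROVED). The tree's spelling for the inverse transform.
[cite: ConnesMoscovici2022, §1 ¶1 (= arXiv:2112.05500 §2 ¶1, chunk p0004:L29–L37)] -/
theorem fourierInvL2_mem_prolateMax (lam : ℝ) {ξ : L2R} (hξ : ξ ∈ (prolateMax lam).domain) :
    (𝓕⁻ ξ : L2R) ∈ (prolateMax lam).domain :=
  (fourierInv_mem_prolateMax lam ⟨ξ, hξ⟩).1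

/-! ## §D. `dom W_max` is reflection-invariant -/

/-- RH-FREE (PROVED). **`dom W_max` is invariant under the parity exchange `R ξ = ξ(−·)` and
`W_max (R ξ) = R (W_max ξ)`** — here from `R = 𝓕𝓕` (tree `fourier_fourier_eq_compNeg`) and §C
("`W` is real, symmetric and invariant under the parity exchange `x ↦ −x`. These features are
inherited by … `W_max`").
[cite: ConnesMoscovici2022, §1 ¶1 (= arXiv:2112.05500 §2 ¶1, chunk p0004:L13–L16)] -/
theorem compNeg_mem_prolateMax (lam : ℝ) (ξ : (prolateMax lam).domain) :
    ∃ h : Lp.compMeasurePreserving (fun x : ℝ ↦ -x) (Measure.measurePreserving_neg volume)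
        (ξ : L2R) ∈ (prolateMax lam).domain,
      prolateMax lam ⟨_, h⟩ =
        Lp.compMeasurePreserving (fun x : ℝ ↦ -x) (Measure.measurePreserving_neg volume)
          (prolateMax lam ξ) := by
  obtain ⟨h1, h1'⟩ := fourier_mem_prolateMax lam ξ
  obtain ⟨h2, h2'⟩ := fourier_mem_prolateMax lam ⟨_, h1⟩
  have hR : Lp.compMeasurePreserving (fun x : ℝ ↦ -x) (Measure.measurePreserving_neg volume)
      (ξ : L2R) = (𝓕 (𝓕 (ξ : L2R) : L2R) : L2R) :=
    (Literature.Analysis.Fourier.fourier_fourier_eq_compNeg (ξ : L2R)).symm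
  have hmem : Lp.compMeasurePreserving (fun x : ℝ ↦ -x) (Measure.measurePreserving_neg volume)
      (ξ : L2R) ∈ (prolateMax lam).domain := by rw [hR]; exact h2
  refine ⟨hmem, ?_⟩
  have h3 : (⟨_, hmem⟩ : (prolateMax lam).domain) = ⟨(𝓕 (𝓕 (ξ : L2R) : L2R) : L2R), h2⟩ :=
    Subtype.ext hR
  rw [h3, h2', h1', Literature.Analysis.Fourier.fourier_fourier_eq_compNeg]

/-! ## §E. `Ω` is invariant under the Fourier transform -/

/-- RH-FREE (PROVED). **`Ω(𝓕ξ, 𝓕η) = Ω(ξ, η)`** ("the symplectic form `Ω` [is] globally invariant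
under the Fourier transform") — `W_max 𝓕 = 𝓕 W_max` (§C) and unitarity of `𝓕` on `L²(ℝ)`.
[cite: ConnesMoscovici2022, §1 text before Thm 1.6 (= arXiv:2112.05500 §2, chunk p0006:L38–L41)] -/
theorem omegaForm_fourierL2 (lam : ℝ) (ξ η : (prolateMax lam).domain) :
    omegaForm lam ⟨fourierL2 (ξ : L2R), fourierL2_mem_prolateMax lam ξ.2⟩
        ⟨fourierL2 (η : L2R), fourierL2_mem_prolateMax lam η.2⟩ = omegaForm lam ξ η := by
  unfold omegaForm
  rw [prolateMax_fourierL2, prolateMax_fourierL2]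
  simp only [fourierL2]
  rw [Lp.inner_fourier_eq, Lp.inner_fourier_eq]

/-- RH-FREE (PROVED). **`Ω(𝓕ξ, η) = Ω(ξ, 𝓕⁻¹η)`** — the form in which the invariance is used to
transport the boundary functionals (`L_{β̂} = L_β ∘ 𝔽_{e_ℝ}`).
[cite: ConnesMoscovici2022, §1 eq. (1.15) and text before it (= arXiv:2112.05500 §2 (2.15), chunk p0006:L38–L44)] -/
theorem omegaForm_fourierL2_left (lam : ℝ) (ξ η : (prolateMax lam).domain) :
    omegaForm lam ⟨fourierL2 (ξ : L2R), fourierL2_mem_prolateMax lam ξ.2⟩ η =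
      omegaForm lam ξ ⟨(𝓕⁻ (η : L2R) : L2R), fourierInvL2_mem_prolateMax lam η.2⟩ := by
  have hη : fourierL2 (𝓕⁻ (η : L2R) : L2R) = (η : L2R) := by
    simp only [fourierL2]; exact fourier_fourierInv_eq _
  have hmem := fourierL2_mem_prolateMax lam (fourierInvL2_mem_prolateMax lam η.2)
  have h := omegaForm_fourierL2 lam ξ ⟨(𝓕⁻ (η : L2R) : L2R), fourierInvL2_mem_prolateMax lam η.2⟩
  have hsub : (⟨fourierL2 (𝓕⁻ (η : L2R) : L2R), hmem⟩ : (prolateMax lam).domain) = η :=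
    Subtype.ext hη
  rw [hsub] at h
  exact h

end Literature.NumberTheory.ConnesMoscovici2022

end
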